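import Literature.NumberTheory.ComplexMultiplication.CMAlgebraLatticePowersInvertible
import Literature.NumberTheory.ComplexMultiplication.CMAlgebraLatticeOrderClassNumberFormula
import HarnessLib

/-!
# THEOREM C OF DADE–TAUSSKY–ZASSENHAUS AT THE TAME PRIMES: a `ℤ`-submodule `V ⊆ Λ` with `VΛ + pΛ = Λ` contains a
# `p`-local unit of the order `Λ` as soon as `p ≥ dim_ℚ Y` (subspace avoidance over `𝔽_p`; at most `n` maximal
# `Λ`-ideals above `p`), so every full lattice `L` of `Y = L_1 ⊕ ⋯ ⊕ L_t` that is `Λ`-stable at the primes `< n` has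
# ALL ITS POWERS `L^k`, `k ≥ n − 1`, INVERTIBLE — in particular every full lattice of a `2`-dimensional `Y` is
# invertible (Hertling–Larabi 2026 Thm. 10.1 ∕ Thm. 10.3 (b); DTZ62 Theorem C; Singer 1970)

Topic `Literature/NumberTheory/ComplexMultiplication`, namespace `Literature.NumberTheory.ComplexMultiplication`;
lane `lit-hodgefound` (Track 2 foundations library), Layer A3, seat p19 generation 33, row g33-#2 — sequel of g33-#1
(`CMAlgebraLatticePowersInvertible`: Thm. 10.3 (c)(d) = Dedekind's bound, Thm. 10.1 for lattices with LOCAL GENERATORS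
`c_p ∈ L ∩ Y^×`, `(LΛ)_(p) = c_pΛ_(p)`, via `pow_mul_div_div_eq_of_forall_exists_units_locEq`; the chain count
`chain_length_le_finrank`).  This file SUPPLIES the local generators where HL's prime-avoidance argument is legitimate —
at every prime `p ≥ n` — and where it is not needed — at the primes where `L` is `Λ`-stable.  THEOREMS ONLY: no
definition, no instance, no named fact (D-0026, net Literature debt `0`), no `sorry`.

## Source, VERBATIM

C. Hertling, K. Larabi, *Semigroups from full lattices in commutative ℚ-algebras*, arXiv:2602.14973 (2026)
[HertlingLarabi2026], held `paper:arxiv-2602.14973`, §10 Thm. 10.3 (b) and its proof (chunk p0028):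
«(b) A full lattice `L_2 ∈ 𝓛(A)` with `L_2 ∼_w L`, `1_A ∈ L_2` and `L_2 ⊂ Λ` exists. […] Fix a prime number `p ∈ P_0`.
[…] Theorem 3.1 applies to `Λ/pΛ` […] `Λ/pΛ = ⊕_{j=1}^{k̃} A^{(j)}_{Λ,p}`, `A^{(j)}_{Λ,p} = F^{(j)}_{Λ,p} ⊕ N^{(j)}_{Λ,p}`.
Here `k̃ ∈ ℕ`, `A^{(1)}_{Λ,p}, …, A^{(k̃)}_{Λ,p}` are irreducible and local 𝔽_p-algebras […]. An element `b = Σ_j (c_j +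
n_j) ∈ Λ/pΛ` […] is a unit if and only if each `c_j ≠ 0`. Therefore the set of elements in `Λ/pΛ` which are not units is
`⋃_{j=1}^{k̃} (N^{(j)}_{Λ,p} ⊕ ⊕_{l≠j} A^{(l)}_{Λ,p})`, so it is a union of `k̃` proper `Λ/pΛ`-ideals. The 𝔽_p-subspace
`(L_1+pΛ)/pΛ` is not contained in any one of these `Λ/pΛ`-ideals because `(L_1+pΛ)/pΛ · Λ/pΛ = Λ/pΛ`. So it is also
not contained in their union. Therefore we can choose an element `b_p ∈ L_1 ⊂ Λ` with
`[b_p] = b_p + pΛ ∈ (L_1+pΛ)/pΛ ∩ (Λ/pΛ)^{unit}`. By Lemma 7.5 (b) `b_p ∈ Λ_(p)^{unit}`.»  And Thm. 10.1 (chunk p0026):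
«Let `A` be a commutative ℚ-algebra of dimension `n ∈ ℤ_{≥2}` with unit element `1_A`. For each full lattice `L ∈ 𝓛(A)`
each power `L^k` with `k ≥ n−1` is invertible. […] In the case of an algebraic number field Theorem 10.2 and [DTZ62,
Theorem 1.5.1] become trivial. Then one can choose `Λ = Λ_max`.»

THE GAP AND ITS REPAIR HERE.  «So it is also not contained in their union» treats the `𝔽_p`-SUBSPACE `(L_1+pΛ)/pΛ` as if
prime avoidance applied to it; a vector space over `𝔽_p` avoids a union of proper subspaces only when there are at most
`p` of them (§1 below, sharp: `𝔽_2²` is the union of its three lines, and `A = ℚ³`, `p = 2`,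
`L_1/2Λ = {000, 110, 011, 101}` defeats (b) as printed, see g33-#1).  Since `k̃ ≤ dim_{𝔽_p} Λ/pΛ = n` (§2), the
printed argument is correct for every prime `p ≥ n`; at primes where `L_(p) = (LΛ)_(p)` no avoidance is needed (§3).

## What is proved (`Y = ∏ᵢ Lᵢ`; `M, V, Λ : Submodule ℤ Y`; `n = finrank ℚ Y`; vocabulary of g31–g33: orders
`1 ∈ Λ ∧ ΛΛ ⊆ Λ`, «invertible» `M·((M/M)/M) = M/M`, «agree at `p`» `∃ s, p ∤ s ∧ sM ⊆ N ∧ sN ⊆ M`, «`p`-local unit of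
`Λ`» `∃ b ∈ Λ, ∃ r, p ∤ r ∧ vb = r·1`, `pΛ = (ℤp)·Λ`)

* §1 **`exists_mem_forall_not_mem_of_card_le_prime`** — SUBSPACE AVOIDANCE OVER `𝔽_p` in lattice form: `≤ p` subgroups `W`
  with `pV ⊆ W ⊉ V` do not cover `V` (private vectors `u_1, u_2`; the `p − 1` vectors `u_1 + a·u_2` fall into pairwise
  distinct further members).
* §2 `finite_setOf_span_natCast_mul_le_le` (finitely many lattices between `pΛ` and `Λ`: `[Λ : pΛ] = p^n`, g33-#1),
  `exists_mul_eq_smul_one_of_le_span_mul_sup` (`vΛ + pΛ = Λ` ⟹ `v` is a `p`-local unit, Nakayama g32-#3),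
  **`card_comaximal_le_finrank`** (pairwise comaximal proper `Λ`-ideals above `p` are `≤ n`: the chain
  `Λ ⊋ 𝔐_0 ⊋ 𝔐_0 ∩ 𝔐_1 ⊋ ⋯` and `chain_length_le_finrank`), and the avoidance theorem
  **`exists_mem_mul_eq_smul_one_of_finrank_le`**: `n ≤ p`, `V ⊆ Λ`, `Λ ⊆ VΛ + pΛ` ⟹ some `v ∈ V` is a `p`-local unit
  of `Λ` (maximal proper `Λ`-ideals above `p` via `Set.Finite.exists_le_maximal`; two distinct ones are comaximal).
* §3 local generators of `LΛ` in `L`: **`exists_units_mem_locEq_of_locEq_mul`** (at a `Λ`-stable prime, from the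
  tree's Thm. 7.3 form `exists_units_mem_locEq_smul_of_mul_div_div_eq`) and **`exists_units_mem_locEq_of_finrank_le`**
  (at every `p ≥ n`, from §2 with `V = a⁻¹L ∩ Λ`).
* §4 **`pow_mul_div_div_eq_of_forall_prime_lt_finrank_locEq`** — THM. 10.1 ∕ THEOREM C for every full lattice `L` and
  order `Λ` with `LΛ ∈ G(Λ)` such that `L_(p) = (LΛ)_(p)` at each prime `p < n`: all `L^k`, `k ≥ n − 1`, are invertible
  with a common order `Λ_2 ⊆ Λ`; **`pow_mul_div_div_eq_of_forall_prime_lt_finrank_locEq_pi`** — the same over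
  `Λ_max = ⊕ 𝒪_{Lᵢ}` (so: Theorem C for every `L` whose conductor primes are `≥ n`); and
  **`mul_div_div_eq_of_finrank_eq_two`** — in dimension `2` EVERY full lattice is invertible, unconditionally.
NOT here (the residual case of Theorem C): primes `p < n` at which `L` is not `Λ_max`-stable and `Λ_max` has more than
`p` maximal ideals above `p` (e.g. `n = 3`, `p = 2` totally split); DTZ62's maximal-ideal proof is not held (acq-11370).

## References
* [HertlingLarabi2026] C. Hertling, K. Larabi, arXiv:2602.14973 (2026), §10 Thm. 10.1, Thm. 10.2 (remark), Thm. 10.3 (b)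
  with proof (chunks p0026–p0028); §7 Thm. 7.3, Lemma 7.5 (b) (chunk p0018). [cite: HertlingLarabi2026, §10 Thm. 10.3 (b), chunk p0028]
* [DadeTausskyZassenhaus1962] E. C. Dade, O. Taussky, H. Zassenhaus, Math. Ann. 148 (1962) 31–64, §1.5 Theorem C (as cited
  by HL 2026 §10; not held). [cite: DadeTausskyZassenhaus1962, §1.5 Theorem C (as cited by HertlingLarabi2026 §10)]
* D. A. Cox, *Primes of the form x² + ny²*, 2nd ed. (2013), §7.A Prop. 7.4 (the quadratic-field case of §4's last
  theorem; tree: `NumberTheory/QuadraticFields/QuadraticOrdersInvertibleLattices`). [cite: Cox2013, §7.A Prop. 7.4]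
-/

noncomputable section

open scoped Classical Pointwise nonZeroDivisors NumberField
open Module NumberField Function

namespace Literature.NumberTheory.ComplexMultiplication

open Literature.NumberTheory.Automorphic

section LargePrimes

variable {t : Type} {L : t → Type} [∀ i, Field (L i)] [∀ i, NumberField (L i)]

/-! ## §1 Avoidance: `≤ p` proper subgroups containing `pV` do not cover `V` -/

omit [∀ i, NumberField (L i)] in
/-- `a·u ∈ W`, `p ∤ a`, `p·u ∈ W ⟹ u ∈ W` (Bézout; file-local). [folklore] -/
private theorem mem_of_zsmul_mem_of_not_dvd {W : Submodule ℤ (Π i, L i)} {u : Π i, L i} {p : ℕ} (hp : p.Prime)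
    {a : ℤ} (ha : ¬ (p : ℤ) ∣ a) (hau : a • u ∈ W) (hpu : (p : ℤ) • u ∈ W) : u ∈ W := by
  obtain ⟨x, y, hxy⟩ := ((Nat.prime_iff_prime_int.1 hp).coprime_iff_not_dvd.2 ha : IsCoprime (p : ℤ) a)
  have hu : u = x • ((p : ℤ) • u) + y • (a • u) := by
    rw [smul_smul, smul_smul, ← add_smul, hxy, one_smul]
  rw [hu]
  exact W.add_mem (W.smul_mem x hpu) (W.smul_mem y hau)

omit [∀ i, NumberField (L i)] in
/-- **SUBSPACE AVOIDANCE OVER `𝔽_p` (lattice form): a `ℤ`-module `V` is not covered by `≤ p` subgroups `W` with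
`pV ⊆ W ⊉ V`** — a vector space over `𝔽_p` is not a union of `p` proper subspaces (given private vectors
`u_1 ∈ W_1`, `u_2 ∈ W_2`, the `p − 1` vectors `u_1 + a·u_2`, `0 < a < p`, lie in pairwise different members other than
`W_1, W_2`).  This is the avoidance step of HL's proof of Thm. 10.3 (b) («`(L_1+pΛ)/pΛ` is not contained in any one of these
`Λ/pΛ`-ideals … So it is also not contained in their union»), valid for an `𝔽_p`-SUBSPACE exactly when the union has at
most `p` members.  (The same pigeonhole for IDEALS `𝔭² ⊆ B ⊊ 𝔭` of a ring with finite residue field is the tree's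
`NumberRing.exists_mem_forall_not_mem_of_card_le` in `CMOrderSuperficialElements`; here the scalars are integers
`0 < a < p` acting on a `ℤ`-module.) [cite: HertlingLarabi2026, §10 Thm. 10.3 (b) (proof), chunk p0028] -/
theorem exists_mem_forall_not_mem_of_card_le_prime {p : ℕ} (hp : p.Prime) {V : Submodule ℤ (Π i, L i)}
    (S : Finset (Submodule ℤ (Π i, L i))) (hS : ∀ W ∈ S, ¬ V ≤ W)
    (hpV : ∀ W ∈ S, ∀ v ∈ V, (p : ℤ) • v ∈ W) (hcard : S.card ≤ p) : ∃ v ∈ V, ∀ W ∈ S, v ∉ W := by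
  induction S using Finset.strongInduction with
  | H S ih =>
    by_cases hred : ∃ W₀ ∈ S, ∀ v ∈ V, v ∈ W₀ → ∃ W ∈ S.erase W₀, v ∈ W
    · -- a redundant member: avoid the others, then `W₀` is avoided as well
      obtain ⟨W₀, hW₀, hW₀red⟩ := hred
      obtain ⟨v, hv, hvS⟩ := ih (S.erase W₀) (Finset.erase_ssubset hW₀)
        (fun W hW => hS W (Finset.mem_of_mem_erase hW)) (fun W hW => hpV W (Finset.mem_of_mem_erase hW))
        ((Finset.card_erase_le).trans hcard)
      refine ⟨v, hv, fun W hW hvW => ?_⟩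
      by_cases hWW : W = W₀
      · subst hWW
        obtain ⟨W', hW', hvW'⟩ := hW₀red v hv hvW
        exact hvS W' hW' hvW'
      · exact hvS W (Finset.mem_erase.2 ⟨hWW, hW⟩) hvW
    · push Not at hred
      -- every member has a private vector
      rcases S.eq_empty_or_nonempty with hS0 | ⟨W₁, hW₁⟩
      · exact ⟨0, V.zero_mem, by simp [hS0]⟩
      rcases (S.erase W₁).eq_empty_or_nonempty with hS1 | ⟨W₂, hW₂⟩
      · obtain ⟨v, hv, hvW⟩ := Set.not_subset.1 (hS W₁ hW₁)
        refine ⟨v, hv, fun W hW => ?_⟩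
        have hWW : W = W₁ := by
          by_contra hne
          have hmem : W ∈ S.erase W₁ := Finset.mem_erase.2 ⟨hne, hW⟩
          rw [hS1] at hmem
          exact absurd hmem (Finset.notMem_empty _)
        rw [hWW]
        exact hvW
      · have hW₂S : W₂ ∈ S := Finset.mem_of_mem_erase hW₂
        have hne : W₂ ≠ W₁ := (Finset.mem_erase.1 hW₂).1
        obtain ⟨u₁, hu₁V, hu₁W₁, hu₁out⟩ := hred W₁ hW₁
        obtain ⟨u₂, hu₂V, hu₂W₂, hu₂out⟩ := hred W₂ hW₂S
        by_contra hnone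
        push Not at hnone
        -- `w_a = u₁ + a·u₂ ∈ f(a) ∈ S` for every integer `a`
        have hw : ∀ a : ℤ, ∃ W ∈ S, u₁ + a • u₂ ∈ W := fun a => hnone _ (V.add_mem hu₁V (V.smul_mem _ hu₂V))
        choose f hfS hfw using hw
        have hf1 : ∀ a : ℤ, 0 < a → a < p → f a ≠ W₁ := fun a ha0 hap heq => by
          have h := hfw a
          rw [heq] at h
          have hau : a • u₂ ∈ W₁ := by simpa using W₁.sub_mem h hu₁W₁
          have hnd : ¬ (p : ℤ) ∣ a := fun hd => by
            have := Int.eq_zero_of_dvd_of_nonneg_of_lt ha0.le hap hd; omega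
          exact hu₂out W₁ (Finset.mem_erase.2 ⟨hne.symm, hW₁⟩)
            (mem_of_zsmul_mem_of_not_dvd hp hnd hau (hpV W₁ hW₁ u₂ hu₂V))
        have hf2 : ∀ a : ℤ, f a ≠ W₂ := fun a heq => by
          have h := hfw a
          rw [heq] at h
          have hu₁ : u₁ ∈ W₂ := by simpa using W₂.sub_mem h (W₂.smul_mem a hu₂W₂)
          exact hu₁out W₂ hW₂ hu₁
        have hinj : Set.InjOn f (Finset.Ico (1 : ℤ) p) := by
          intro a ha b hb hab
          rw [Finset.coe_Ico, Set.mem_Ico] at ha hb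
          by_contra hne'
          have hmem : (a - b) • u₂ ∈ f a := by
            have h := (f a).sub_mem (hfw a) (hab ▸ hfw b)
            rwa [add_sub_add_left_eq_sub, ← sub_smul] at h
          have hnd : ¬ (p : ℤ) ∣ (a - b) := fun hd => by
            rcases lt_or_gt_of_ne hne' with hlt | hlt
            · have hd' : (p : ℤ) ∣ (b - a) := by rwa [← dvd_neg, neg_sub] at hd
              have := Int.eq_zero_of_dvd_of_nonneg_of_lt (by omega) (by omega) hd'
              omega
            · have := Int.eq_zero_of_dvd_of_nonneg_of_lt (by omega) (by omega) hd
              omega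
          exact hu₂out (f a) (Finset.mem_erase.2 ⟨hf2 a, hfS a⟩)
            (mem_of_zsmul_mem_of_not_dvd hp hnd hmem (hpV _ (hfS a) u₂ hu₂V))
        -- count: `a ↦ f a` embeds `[1, p)` into `S ∖ {W₁, W₂}`
        have himage : (Finset.Ico (1 : ℤ) p).image f ⊆ (S.erase W₁).erase W₂ := by
          intro W hW
          obtain ⟨a, ha, rfl⟩ := Finset.mem_image.1 hW
          rw [Finset.mem_Ico] at ha
          exact Finset.mem_erase.2 ⟨hf2 a, Finset.mem_erase.2 ⟨hf1 a (by omega) ha.2, hfS a⟩⟩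
        have hcount : p - 1 ≤ ((S.erase W₁).erase W₂).card := by
          calc p - 1 = (Finset.Ico (1 : ℤ) p).card := by rw [Int.card_Ico]; omega
            _ = ((Finset.Ico (1 : ℤ) p).image f).card := (Finset.card_image_of_injOn hinj).symm
            _ ≤ ((S.erase W₁).erase W₂).card := Finset.card_le_card himage
        rw [Finset.card_erase_of_mem hW₂, Finset.card_erase_of_mem hW₁] at hcount
        have h2 : 2 ≤ S.card := by
          have h1 := Finset.card_pos.2 ⟨W₂, hW₂⟩
          rw [Finset.card_erase_of_mem hW₁] at h1
          omega
        have hp2 := hp.two_le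
        omega

/-! ## §2 Maximal `Λ`-ideals above `p`: at most `n = dim_ℚ Y` of them; non-units lie in one of them -/

omit [∀ i, NumberField (L i)] in
/-- `x ∈ (ℤp)·N ⟺ x = p·y`, `y ∈ N` (file-local copy of the g33-#1 spelling). [folklore] -/
private theorem mem_span_natCast_mul_iff' {p : ℕ} {N : Submodule ℤ (Π i, L i)} {x : Π i, L i} :
    x ∈ Submodule.span ℤ {(p : Π i, L i)} * N ↔ ∃ y ∈ N, x = (p : ℤ) • y := by
  rw [Submodule.mem_span_singleton_mul]
  constructor
  · rintro ⟨z, hz, rfl⟩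
    exact ⟨z, hz, by rw [zsmul_eq_mul, Int.cast_natCast]⟩
  · rintro ⟨y, hy, rfl⟩
    exact ⟨y, hy, by rw [zsmul_eq_mul, Int.cast_natCast]⟩

/-- **The lattices between `pΛ` and `Λ` are finitely many** (`Λ/pΛ` is finite of order `p^n`).
[cite: HertlingLarabi2026, §10 Thm. 10.3 (b)(d) (proof: «the `n`-dimensional `𝔽_p`-vector space `Λ/pΛ`»), chunk p0028] -/
theorem finite_setOf_span_natCast_mul_le_le {Λ : Submodule ℤ (Π i, L i)} (hΛ : IsFullLattice (Π i, L i) Λ)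
    {p : ℕ} (hp : p ≠ 0) :
    {N : Submodule ℤ (Π i, L i) | Submodule.span ℤ {(p : Π i, L i)} * Λ ≤ N ∧ N ≤ Λ}.Finite := by
  set P : Submodule ℤ (Π i, L i) := Submodule.span ℤ {(p : Π i, L i)} * Λ with hP
  -- the finite quotient `Λ/pΛ`
  let Q : Submodule ℤ Λ := P.comap Λ.subtype
  have hidx : Q.toAddSubgroup.index = p ^ finrank ℚ (Π i, L i) := by
    rw [← relIndex_span_natCast_mul_eq_pow hΛ hp, AddSubgroup.relIndex]
    congr 1
  haveI : Q.toAddSubgroup.FiniteIndex := AddSubgroup.finiteIndex_iff.2 (by rw [hidx]; exact pow_ne_zero _ hp)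
  haveI : Finite (Λ ⧸ Q) := AddSubgroup.finite_quotient_of_finiteIndex (H := Q.toAddSubgroup)
  -- `N ↦ image of N ∩ Λ in Λ/pΛ` is injective on the interval
  let φ : {N : Submodule ℤ (Π i, L i) // P ≤ N ∧ N ≤ Λ} → Submodule ℤ (Λ ⧸ Q) :=
    fun N => (N.1.comap Λ.subtype).map Q.mkQ
  have hφ : Function.Injective φ := by
    rintro ⟨N, hPN, hNΛ⟩ ⟨N', hPN', hN'Λ⟩ h
    have key : ∀ {N : Submodule ℤ (Π i, L i)}, P ≤ N → N ≤ Λ →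
        ((((N.comap Λ.subtype).map Q.mkQ).comap Q.mkQ).map Λ.subtype) = N := fun {N} hPN hNΛ => by
      rw [Submodule.comap_map_eq, Submodule.ker_mkQ, sup_eq_left.2 (Submodule.comap_mono hPN),
        Submodule.map_comap_eq, Submodule.range_subtype, inf_eq_right.2 hNΛ]
    apply Subtype.ext
    change N = N'
    rw [← key hPN hNΛ, ← key hPN' hN'Λ]
    exact congrArg (fun X : Submodule ℤ (Λ ⧸ Q) => (X.comap Q.mkQ).map Λ.subtype) h
  haveI : Finite {N : Submodule ℤ (Π i, L i) // P ≤ N ∧ N ≤ Λ} := Finite.of_injective φ hφ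
  exact Set.finite_coe_iff.1 ‹_›

omit [∀ i, NumberField (L i)] in
/-- A proper `Λ`-ideal `N` with `pΛ ⊆ N ⊊ Λ` CANNOT contain an element `v` that is a unit of `Λ` at `p`
(`vb = 1 + pc` or `vb = r·1`, `p ∤ r`): then `r·1 ∈ N`... — contrapositive spelling used below: if `vΛ + pΛ = Λ` then
`v` is a local unit. [cite: HertlingLarabi2026, §7 Lemma 7.5 (b), chunk p0018] -/
theorem exists_mul_eq_smul_one_of_le_span_mul_sup {Λ : Submodule ℤ (Π i, L i)} (hΛ : IsFullLattice (Π i, L i) Λ)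
    (h1Λ : (1 : Π i, L i) ∈ Λ) (hΛΛ : Λ * Λ ≤ Λ) {p : ℕ} (hp : p.Prime) {v : Π i, L i}
    (h : Λ ≤ Submodule.span ℤ {v} * Λ ⊔ Submodule.span ℤ {(p : Π i, L i)} * Λ) :
    ∃ b ∈ Λ, ∃ r : ℤ, ¬ (p : ℤ) ∣ r ∧ v * b = r • (1 : Π i, L i) := by
  obtain ⟨y, hy, z, hz, hyz⟩ := Submodule.mem_sup.1 (h h1Λ)
  obtain ⟨b, hb, rfl⟩ := Submodule.mem_span_singleton_mul.1 hy
  obtain ⟨c, hc, rfl⟩ := mem_span_natCast_mul_iff'.1 hz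
  refine (exists_mul_eq_smul_one_iff_exists_mul_eq_one_add hΛ h1Λ hΛΛ hp v).2 ⟨b, hb, -c, Λ.neg_mem hc, ?_⟩
  rw [smul_neg, ← hyz]
  abel

omit [∀ i, NumberField (L i)] in
/-- `(ℤp)·N ⊆ N` (file-local). [folklore] -/
private theorem span_natCast_mul_le' (p : ℕ) (N : Submodule ℤ (Π i, L i)) :
    Submodule.span ℤ {(p : Π i, L i)} * N ≤ N := fun x hx => by
  obtain ⟨y, hy, rfl⟩ := mem_span_natCast_mul_iff'.1 hx
  exact N.smul_mem _ hy

omit [∀ i, NumberField (L i)] in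
/-- `Λ`-ideals absorb: `𝔐·X ⊆ 𝔐` and `X·𝔐 ⊆ 𝔐` for `X ⊆ Λ`, `Λ𝔐 ⊆ 𝔐` (file-local). [folklore] -/
private theorem ideal_mul_le_of_le {Λ 𝔐 X : Submodule ℤ (Π i, L i)} (hX : X ≤ Λ) (h𝔐 : Λ * 𝔐 ≤ 𝔐) :
    𝔐 * X ≤ 𝔐 ∧ X * 𝔐 ≤ 𝔐 :=
  ⟨by rw [mul_comm]; exact (mul_le_mul_left hX _).trans h𝔐, (mul_le_mul_left hX _).trans h𝔐⟩

/-- **PAIRWISE COMAXIMAL PROPER `Λ`-IDEALS ABOVE `p` ARE AT MOST `n = dim_ℚ Y` IN NUMBER**: for `Λ`-ideals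
`pΛ ⊆ 𝔐_0, …, 𝔐_{k−1} ⊊ Λ` with `𝔐_i + 𝔐_j = Λ` (`i ≠ j`), the chain `Λ ⊋ 𝔐_0 ⊋ 𝔐_0 ∩ 𝔐_1 ⊋ ⋯` decreases strictly
(Chinese-remainder step `Λ ⊆ 𝔐_j + ⋂_{i<m} 𝔐_i` for `j ≥ m`), so `k ≤ n` by `chain_length_le_finrank` — the count of the
local factors «`Λ/pΛ = ⊕_{j=1}^{k̃} A^{(j)}_{Λ,p}`» of the `n`-dimensional `𝔽_p`-algebra `Λ/pΛ`. [cite: HertlingLarabi2026, §10 Thm. 10.3 (b) (proof: the decomposition of `Λ/pΛ` into local algebras), chunk p0028] -/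
theorem card_comaximal_le_finrank {Λ : Submodule ℤ (Π i, L i)} (hΛ : IsFullLattice (Π i, L i) Λ)
    (h1Λ : (1 : Π i, L i) ∈ Λ) (hΛΛ : Λ * Λ ≤ Λ) {p : ℕ} (hp : p.Prime) {k : ℕ}
    (𝔐 : ℕ → Submodule ℤ (Π i, L i)) (hP : ∀ i < k, Submodule.span ℤ {(p : Π i, L i)} * Λ ≤ 𝔐 i)
    (hΛ' : ∀ i < k, 𝔐 i ≤ Λ) (hid : ∀ i < k, Λ * 𝔐 i ≤ 𝔐 i) (hne : ∀ i < k, 𝔐 i ≠ Λ)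
    (hco : ∀ i j, i < k → j < k → i ≠ j → 𝔐 i ⊔ 𝔐 j = Λ) : k ≤ finrank ℚ (Π i, L i) := by
  -- `I m = Λ ∩ 𝔐_0 ∩ ⋯ ∩ 𝔐_{m-1}`
  let I : ℕ → Submodule ℤ (Π i, L i) := fun m => Nat.rec Λ (fun i J => J ⊓ 𝔐 i) m
  have hI0 : I 0 = Λ := rfl
  have hIs : ∀ m, I (m + 1) = I m ⊓ 𝔐 m := fun m => rfl
  have hIle : ∀ m, I m ≤ Λ := fun m => by
    induction m with
    | zero => exact le_rfl
    | succ m ih => rw [hIs]; exact inf_le_left.trans ih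
  have hIP : ∀ m ≤ k, Submodule.span ℤ {(p : Π i, L i)} * Λ ≤ I m := fun m hm => by
    induction m with
    | zero => rw [hI0]; exact span_natCast_mul_le' p Λ
    | succ m ih => rw [hIs]; exact le_inf (ih (Nat.le_of_succ_le hm)) (hP m (Nat.lt_of_succ_le hm))
  have hIid : ∀ m ≤ k, Λ * I m ≤ I m := fun m hm => by
    induction m with
    | zero => rw [hI0]; exact hΛΛ
    | succ m ih =>
      rw [hIs]
      exact le_inf ((mul_le_mul_right inf_le_left _).trans (ih (Nat.le_of_succ_le hm)))
        ((mul_le_mul_right inf_le_right _).trans (hid m (Nat.lt_of_succ_le hm)))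
  -- Chinese-remainder step: `Λ ⊆ 𝔐_j + I_m` for `m ≤ j < k`
  have hcrt : ∀ m ≤ k, ∀ j, m ≤ j → j < k → Λ ≤ 𝔐 j ⊔ I m := by
    intro m
    induction m with
    | zero => intro _ j _ _; rw [hI0]; exact le_sup_right
    | succ m ih =>
      intro hm j hmj hjk
      have hmk : m < k := Nat.lt_of_succ_le hm
      have h1 : Λ ≤ 𝔐 j ⊔ I m := ih hmk.le j (Nat.le_of_succ_le hmj) hjk
      have h2 : Λ ≤ 𝔐 j ⊔ 𝔐 m := (hco j m hjk hmk (by omega)).symm.le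
      calc Λ ≤ Λ * Λ := fun x hx => by rw [← mul_one x]; exact Submodule.mul_mem_mul hx h1Λ
        _ ≤ (𝔐 j ⊔ I m) * (𝔐 j ⊔ 𝔐 m) := mul_le_mul' h1 h2
        _ ≤ 𝔐 j ⊔ I (m + 1) := by
          rw [Submodule.mul_sup, Submodule.sup_mul, Submodule.sup_mul, hIs]
          refine sup_le (sup_le ?_ ?_) (sup_le ?_ ?_)
          · exact (ideal_mul_le_of_le (hΛ' j hjk) (hid j hjk)).1.trans le_sup_left
          · exact (ideal_mul_le_of_le (hIle m) (hid j hjk)).2.trans le_sup_left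
          · exact (ideal_mul_le_of_le (hΛ' m hmk) (hid j hjk)).1.trans le_sup_left
          · exact (le_inf (ideal_mul_le_of_le (hΛ' m hmk) (hIid m hmk.le)).1
              (ideal_mul_le_of_le (hIle m) (hid m hmk)).2).trans le_sup_right
  -- strictness: `I_{m+1} ⊊ I_m` for `m < k`
  have hlt : ∀ m < k, I (m + 1) < I m := fun m hm => by
    rw [hIs]
    refine lt_of_le_of_ne inf_le_left fun heq => hne m hm (le_antisymm (hΛ' m hm) ?_)
    have hIm : I m ≤ 𝔐 m := fun x hx => by
      have hx' : x ∈ I m ⊓ 𝔐 m := heq.symm ▸ hx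
      exact hx'.2
    calc Λ ≤ 𝔐 m ⊔ I m := hcrt m hm.le m le_rfl hm
      _ ≤ 𝔐 m := sup_le le_rfl hIm
  -- the increasing chain `j ↦ I (k - j)`
  refine chain_length_le_finrank hΛ hp (fun j => I (k - j)) ?_ ?_ ?_
  · rw [Nat.sub_zero]
    exact hIP k le_rfl
  · rw [Nat.sub_self, hI0]
  · intro j hj
    rw [show k - j = k - (j + 1) + 1 by omega]
    exact hlt _ (by omega)

/-- **LOCAL UNITS BY AVOIDANCE (the legitimate case of HL's argument): if `dim_ℚ Y ≤ p` then every `ℤ`-submodule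
`V ⊆ Λ` with `VΛ + pΛ = Λ` contains a unit of `Λ_(p)`** (`vb = r·1`, `p ∤ r`): the proper `Λ`-ideals above `p` have at
most `n ≤ p` maximal ones (comaximal count), a non-unit `v` lies in one of them (`vΛ + pΛ ⊊ Λ`), and `≤ p` of them do not
cover `V` (§1).  HL: «the set of elements in `Λ/pΛ` which are not units is … a union of `k̃` proper `Λ/pΛ`-ideals.
The 𝔽_p-subspace `(L_1+pΛ)/pΛ` is not contained in any one of these … So it is also not contained in their union»
— correct as soon as `k̃ ≤ p`, which `k̃ ≤ n ≤ p` guarantees. [cite: HertlingLarabi2026, §10 Thm. 10.3 (b) (proof), chunk p0028] -/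
theorem exists_mem_mul_eq_smul_one_of_finrank_le {V Λ : Submodule ℤ (Π i, L i)}
    (hΛ : IsFullLattice (Π i, L i) Λ) (h1Λ : (1 : Π i, L i) ∈ Λ) (hΛΛ : Λ * Λ ≤ Λ) {p : ℕ} (hp : p.Prime)
    (hnp : finrank ℚ (Π i, L i) ≤ p) (hVΛ : V ≤ Λ)
    (hgen : Λ ≤ V * Λ ⊔ Submodule.span ℤ {(p : Π i, L i)} * Λ) :
    ∃ v ∈ V, ∃ b ∈ Λ, ∃ r : ℤ, ¬ (p : ℤ) ∣ r ∧ v * b = r • (1 : Π i, L i) := by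
  classical
  set P : Submodule ℤ (Π i, L i) := Submodule.span ℤ {(p : Π i, L i)} * Λ with hP
  -- proper `Λ`-ideals above `p`, and the maximal ones among them
  let 𝓘 : Set (Submodule ℤ (Π i, L i)) := {N | P ≤ N ∧ N ≤ Λ ∧ Λ * N ≤ N ∧ N ≠ Λ}
  have h𝓘fin : 𝓘.Finite :=
    (finite_setOf_span_natCast_mul_le_le hΛ hp.ne_zero).subset fun N hN => ⟨hN.1, hN.2.1⟩
  have h𝓜fin : {N | Maximal (· ∈ 𝓘) N}.Finite := h𝓘fin.subset fun N hN => hN.prop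
  set S : Finset (Submodule ℤ (Π i, L i)) := h𝓜fin.toFinset with hS
  have hmemS : ∀ N, N ∈ S ↔ Maximal (· ∈ 𝓘) N := fun N => by
    rw [hS, Set.Finite.mem_toFinset, Set.mem_setOf_eq]
  -- two distinct maximal ideals are comaximal
  have hco : ∀ N ∈ S, ∀ N' ∈ S, N ≠ N' → N ⊔ N' = Λ := by
    intro N hN N' hN' hNN'
    rw [hmemS] at hN hN'
    by_contra hne
    have hsup : N ⊔ N' ∈ 𝓘 := ⟨hN.prop.1.trans le_sup_left, sup_le hN.prop.2.1 hN'.prop.2.1,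
      by rw [Submodule.mul_sup]; exact sup_le_sup hN.prop.2.2.1 hN'.prop.2.2.1, hne⟩
    exact hNN' (le_antisymm (le_sup_left.trans (hN'.2 hsup le_sup_right)) (le_sup_right.trans (hN.2 hsup le_sup_left)))
  -- at most `n ≤ p` maximal ideals
  have hcard : S.card ≤ p := by
    refine le_trans ?_ hnp
    let e := S.equivFin
    let 𝔐 : ℕ → Submodule ℤ (Π i, L i) := fun i =>
      if h : i < S.card then ((e.symm ⟨i, h⟩ : S) : Submodule ℤ (Π i, L i)) else Λ
    have h𝔐 : ∀ i (hi : i < S.card), 𝔐 i = ((e.symm ⟨i, hi⟩ : S) : Submodule ℤ (Π i, L i)) :=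
      fun i hi => dif_pos hi
    have h𝔐S : ∀ i (hi : i < S.card), Maximal (· ∈ 𝓘) (𝔐 i) := fun i hi => by
      rw [← hmemS, h𝔐 i hi]; exact (e.symm ⟨i, hi⟩).2
    refine card_comaximal_le_finrank hΛ h1Λ hΛΛ hp 𝔐 (fun i hi => (h𝔐S i hi).prop.1)
      (fun i hi => (h𝔐S i hi).prop.2.1) (fun i hi => (h𝔐S i hi).prop.2.2.1)
      (fun i hi => (h𝔐S i hi).prop.2.2.2) (fun i j hi hj hij => ?_)
    refine hco _ ((hmemS _).2 (h𝔐S i hi)) _ ((hmemS _).2 (h𝔐S j hj)) fun heq => hij ?_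
    rw [h𝔐 i hi, h𝔐 j hj] at heq
    have hij' := e.symm.injective (Subtype.ext heq)
    simpa using hij'
  -- `V` lies in no maximal ideal, and `pV ⊆` each of them
  have hS1 : ∀ W ∈ S, ¬ V ≤ W := fun W hW hVW => by
    rw [hmemS] at hW
    refine hW.prop.2.2.2 (le_antisymm hW.prop.2.1 (hgen.trans (sup_le ?_ hW.prop.1)))
    calc V * Λ ≤ W * Λ := mul_le_mul_left hVW _
      _ ≤ W := (ideal_mul_le_of_le le_rfl hW.prop.2.2.1).1
  have hS2 : ∀ W ∈ S, ∀ v ∈ V, (p : ℤ) • v ∈ W := fun W hW v hv => by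
    rw [hmemS] at hW
    exact hW.prop.1 (mem_span_natCast_mul_iff'.2 ⟨v, hVΛ hv, rfl⟩)
  -- avoidance
  obtain ⟨v, hv, hvS⟩ := exists_mem_forall_not_mem_of_card_le_prime hp S hS1 hS2 hcard
  refine ⟨v, hv, ?_⟩
  by_contra hnot
  -- `vΛ + pΛ` is then a proper `Λ`-ideal above `p`, contained in a maximal one — which contains `v`
  have hNv : Submodule.span ℤ {v} * Λ ⊔ P ∈ 𝓘 := by
    refine ⟨le_sup_right, sup_le ?_ (span_natCast_mul_le' p Λ), ?_, fun heq => hnot ?_⟩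
    · exact Submodule.mul_le.2 fun a ha b hb => by
        obtain ⟨m, rfl⟩ := Submodule.mem_span_singleton.1 ha
        rw [smul_mul_assoc]
        exact Λ.smul_mem m (hΛΛ (Submodule.mul_mem_mul (hVΛ hv) hb))
    · rw [Submodule.mul_sup]
      refine sup_le_sup ?_ ?_
      · rw [mul_left_comm]; exact mul_le_mul_right hΛΛ _
      · rw [hP, mul_left_comm]; exact mul_le_mul_right hΛΛ _
    · exact exists_mul_eq_smul_one_of_le_span_mul_sup hΛ h1Λ hΛΛ hp heq.symm.le
  obtain ⟨𝔐, hN𝔐, h𝔐max⟩ := h𝓘fin.exists_le_maximal hNv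
  have hvmem : v ∈ 𝔐 :=
    hN𝔐 (Submodule.mem_sup_left (Submodule.mem_span_singleton_mul.2 ⟨1, h1Λ, mul_one v⟩))
  exact hvS 𝔐 ((hmemS 𝔐).2 h𝔐max) hvmem

/-! ## §3 Local generators of `LΛ` inside `L`: at `Λ`-stable primes, and at primes `p ≥ n` -/

omit [∀ i, NumberField (L i)] in
/-- `N` and `uN` agree at `p` when `u = s·1` with `p ∤ s` (file-local). [folklore] -/
private theorem locEq_units_smul_of_coe_eq_zsmul_one {p : ℕ} {s : ℤ} (hs : ¬ (p : ℤ) ∣ s) {u : (Π i, L i)ˣ}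
    (hu : (u : Π i, L i) = s • (1 : Π i, L i)) (N : Submodule ℤ (Π i, L i)) :
    ∃ s' : ℤ, ¬ (p : ℤ) ∣ s' ∧ (∀ x ∈ N, s' • x ∈ u • N) ∧ (∀ x ∈ u • N, s' • x ∈ N) := by
  have hux : ∀ x : Π i, L i, u • x = s • x := fun x => by
    rw [Units.smul_def, hu, smul_eq_mul, smul_mul_assoc, one_mul]
  refine ⟨s, hs, fun x hx => ?_, fun x hx => N.smul_mem s ?_⟩
  · rw [← hux]
    exact Submodule.smul_mem_pointwise_smul x u N hx
  · obtain ⟨y, hy, rfl⟩ := (Submodule.mem_smul_pointwise_iff_exists x u N).1 hx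
    rw [hux]
    exact N.smul_mem s hy

/-- **A local generator of `LΛ` inside `L` at a `Λ`-STABLE prime**: if `LΛ ∈ G(Λ)` (so `(LΛ)_(p) = aΛ_(p)` with
`a ∈ LΛ`, Thm. 7.3 in the tree's sharpened form `exists_units_mem_locEq_smul_of_mul_div_div_eq`) and `L_(p) = (LΛ)_(p)`,
then some `c ∈ L ∩ Y^×` has `(LΛ)_(p) = cΛ_(p)` (namely `c = sa`, `p ∤ s`, `s(LΛ) ⊆ L`).
[cite: HertlingLarabi2026, §7 Thm. 7.3, chunk p0018; §10 Thm. 10.3 (b) (the choice of `b_p`), chunk p0028] -/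
theorem exists_units_mem_locEq_of_locEq_mul {M Λ : Submodule ℤ (Π i, L i)} (hM : IsFullLattice (Π i, L i) M)
    (hΛ : IsFullLattice (Π i, L i) Λ) (hO : (M * Λ) / (M * Λ) = Λ)
    (hinv : (M * Λ) * (((M * Λ) / (M * Λ)) / (M * Λ)) = (M * Λ) / (M * Λ)) {p : ℕ} (hp : p.Prime)
    (hst : ∃ s : ℤ, ¬ (p : ℤ) ∣ s ∧ (∀ x ∈ M, s • x ∈ M * Λ) ∧ (∀ x ∈ M * Λ, s • x ∈ M)) :
    ∃ c : (Π i, L i)ˣ, (c : Π i, L i) ∈ M ∧ ∃ s : ℤ, ¬ (p : ℤ) ∣ s ∧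
      (∀ x ∈ M * Λ, s • x ∈ c • Λ) ∧ (∀ x ∈ c • Λ, s • x ∈ M * Λ) := by
  obtain ⟨a, haM, -, hloc⟩ := exists_units_mem_locEq_smul_of_mul_div_div_eq (isFullLattice_mul hM hΛ) hinv hp
  rw [hO] at hloc
  obtain ⟨s, hs, -, hsM⟩ := hst
  have hs0 : s ≠ 0 := by rintro rfl; exact hs (dvd_zero _)
  have hsu : IsUnit (s • (1 : Π i, L i)) := isUnit_of_mul_eq_smul_one hs0 (mul_one _)
  refine ⟨hsu.unit * a, ?_, ?_⟩
  · rw [Units.val_mul, IsUnit.unit_spec, smul_mul_assoc, one_mul]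
    exact hsM _ haM
  · rw [mul_smul]
    exact locEq_trans hp hloc (locEq_units_smul_of_coe_eq_zsmul_one hs hsu.unit_spec (a • Λ))

/-- **A local generator of `LΛ` inside `L` at every prime `p ≥ n = dim_ℚ Y`**: if `(LΛ)_(p) = aΛ_(p)` for some
`a ∈ Y^×`, then some `c ∈ L ∩ Y^×` has `(LΛ)_(p) = cΛ_(p)` — HL's `b_p`, obtained from `V = a⁻¹L ∩ Λ` (which satisfies
`VΛ + pΛ = Λ`) by the avoidance theorem `exists_mem_mul_eq_smul_one_of_finrank_le` (legitimate since `n ≤ p`).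
[cite: HertlingLarabi2026, §10 Thm. 10.3 (b) (proof), chunk p0028] -/
theorem exists_units_mem_locEq_of_finrank_le {M Λ : Submodule ℤ (Π i, L i)}
    (hΛ : IsFullLattice (Π i, L i) Λ) (h1Λ : (1 : Π i, L i) ∈ Λ) (hΛΛ : Λ * Λ ≤ Λ) {p : ℕ} (hp : p.Prime)
    (hnp : finrank ℚ (Π i, L i) ≤ p) {a : (Π i, L i)ˣ}
    (ha : ∃ s : ℤ, ¬ (p : ℤ) ∣ s ∧ (∀ x ∈ M * Λ, s • x ∈ a • Λ) ∧ (∀ x ∈ a • Λ, s • x ∈ M * Λ)) :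
    ∃ c : (Π i, L i)ˣ, (c : Π i, L i) ∈ M ∧ ∃ s : ℤ, ¬ (p : ℤ) ∣ s ∧
      (∀ x ∈ M * Λ, s • x ∈ c • Λ) ∧ (∀ x ∈ c • Λ, s • x ∈ M * Λ) := by
  obtain ⟨s, hs, h1, h2⟩ := ha
  -- `V = a⁻¹L ∩ Λ`
  set V : Submodule ℤ (Π i, L i) := ((a⁻¹ : (Π i, L i)ˣ) • M) ⊓ Λ with hV
  -- `s·a⁻¹(LΛ) ⊆ VΛ`
  have hkey : ∀ y ∈ M * Λ, s • ((a⁻¹ : (Π i, L i)ˣ) • y) ∈ V * Λ := fun y hy => by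
    refine Submodule.mul_induction_on hy (fun m hm l hl => ?_) (fun x y hx hy => ?_)
    · have hmV : s • ((a⁻¹ : (Π i, L i)ˣ) • m) ∈ V := by
        refine ⟨Submodule.smul_mem _ s (Submodule.smul_mem_pointwise_smul m _ M hm), ?_⟩
        have h := h1 _ (Submodule.mul_mem_mul hm h1Λ)
        rw [mul_one, mem_units_smul_submodule_iff, smul_comm] at h
        exact h
      have e : s • ((a⁻¹ : (Π i, L i)ˣ) • (m * l)) = (s • ((a⁻¹ : (Π i, L i)ˣ) • m)) * l := by
        rw [Units.smul_def, Units.smul_def, smul_eq_mul, smul_eq_mul, ← mul_assoc, smul_mul_assoc]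
      rw [e]
      exact Submodule.mul_mem_mul hmV hl
    · rw [smul_add, smul_add]
      exact Submodule.add_mem _ hx hy
  -- `Λ ⊆ VΛ + pΛ`
  have hgen : Λ ≤ V * Λ ⊔ Submodule.span ℤ {(p : Π i, L i)} * Λ := fun x hx => by
    have hss : (s * s) • x ∈ V * Λ := by
      have h := hkey _ (h2 _ (Submodule.smul_mem_pointwise_smul x a Λ hx))
      rwa [smul_comm (a⁻¹ : (Π i, L i)ˣ) s, inv_smul_smul, smul_smul] at h
    obtain ⟨α, β, hαβ⟩ := ((Nat.prime_iff_prime_int.1 hp).coprime_iff_not_dvd.2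
      (fun h => ((Nat.prime_iff_prime_int.1 hp).dvd_or_dvd h).elim hs hs) : IsCoprime (p : ℤ) (s * s))
    have ex : x = (p : ℤ) • (α • x) + β • ((s * s) • x) := by
      rw [smul_smul, smul_smul, ← add_smul, mul_comm (p : ℤ) α, hαβ, one_smul]
    rw [ex]
    exact Submodule.add_mem _ (Submodule.mem_sup_right (mem_span_natCast_mul_iff'.2 ⟨α • x, Λ.smul_mem α hx, rfl⟩))
      (Submodule.mem_sup_left ((V * Λ).smul_mem β hss))
  obtain ⟨v, hv, b, hb, r, hr, hvb⟩ :=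
    exists_mem_mul_eq_smul_one_of_finrank_le hΛ h1Λ hΛΛ hp hnp inf_le_right hgen
  obtain ⟨hv1, hv2⟩ := Submodule.mem_inf.1 hv
  have hr0 : r ≠ 0 := by rintro rfl; exact hr (dvd_zero _)
  have hvu : IsUnit v := isUnit_of_mul_eq_smul_one hr0 hvb
  refine ⟨a * hvu.unit, ?_, ?_⟩
  · -- `av ∈ L`
    rw [mem_units_smul_submodule_iff, inv_inv, Units.smul_def, smul_eq_mul] at hv1
    rwa [Units.val_mul, IsUnit.unit_spec]
  · -- `(LΛ)_(p) = aΛ_(p) = a(vΛ)_(p)`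
    rw [mul_smul]
    exact locEq_trans hp ⟨s, hs, h1, h2⟩
      (locEq_units_smul a (locEq_units_smul_of_mul_eq_smul_one hΛΛ hv2 hb hr hvb hvu))

/-! ## §4 Thm. 10.1 ∕ DTZ62 Theorem C when the primes below `n` are `Λ`-stable -/

/-- **HL 2026 THM. 10.1 ∕ DTZ62 THEOREM C FOR LATTICES WHOSE SMALL PRIMES ARE `Λ`-STABLE: let `L` be a full lattice in
`Y`, `n = dim_ℚ Y ≥ 2`, `Λ` an order with `LΛ ∈ G(Λ)` (HL's setting after Thm. 10.2; e.g. `Λ = Λ_max ⊇ 𝒪(L)`), and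
suppose `L_(p) = (LΛ)_(p)` for every prime `p < n`.  Then `L^k` is INVERTIBLE for every `k ≥ n − 1`, all with the same
order `Λ_2 ⊆ Λ`.**  (At `p < n` the local generator comes from `Λ`-stability, at `p ≥ n` from the avoidance theorem;
then g33-#1's `pow_mul_div_div_eq_of_forall_exists_units_locEq` = HL's (b) ⟹ (c) ⟹ (d) ⟹ Thm. 10.1.)
[cite: HertlingLarabi2026, §10 Thm. 10.1, Thm. 10.3, chunks p0026–p0028] [cite: DadeTausskyZassenhaus1962, §1.5 Theorem C] -/
theorem pow_mul_div_div_eq_of_forall_prime_lt_finrank_locEq {M Λ : Submodule ℤ (Π i, L i)}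
    (hM : IsFullLattice (Π i, L i) M) (hΛ : IsFullLattice (Π i, L i) Λ) (h1Λ : (1 : Π i, L i) ∈ Λ)
    (hΛΛ : Λ * Λ ≤ Λ) (hO : (M * Λ) / (M * Λ) = Λ)
    (hinv : (M * Λ) * (((M * Λ) / (M * Λ)) / (M * Λ)) = (M * Λ) / (M * Λ))
    (hsmall : ∀ p : ℕ, p.Prime → p < finrank ℚ (Π i, L i) →
      ∃ s : ℤ, ¬ (p : ℤ) ∣ s ∧ (∀ x ∈ M, s • x ∈ M * Λ) ∧ (∀ x ∈ M * Λ, s • x ∈ M))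
    (hn : 2 ≤ finrank ℚ (Π i, L i)) :
    ∃ Λ₂ : Submodule ℤ (Π i, L i), (1 : Π i, L i) ∈ Λ₂ ∧ Λ₂ * Λ₂ = Λ₂ ∧ Λ₂ ≤ Λ ∧
      ∀ k : ℕ, finrank ℚ (Π i, L i) - 1 ≤ k →
        M ^ k * ((M ^ k / M ^ k) / M ^ k) = M ^ k / M ^ k ∧ M ^ k / M ^ k = Λ₂ := by
  obtain ⟨a, P₀, -, hloc⟩ := exists_forall_prime_locEq_units_smul_of_mul_div_div_eq (isFullLattice_mul hM hΛ) hinv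
  refine pow_mul_div_div_eq_of_forall_exists_units_locEq hM hΛ h1Λ hΛΛ (fun p hp _ => ?_) hn
  by_cases hpn : p < finrank ℚ (Π i, L i)
  · exact exists_units_mem_locEq_of_locEq_mul hM hΛ hO hinv hp (hsmall p hp hpn)
  · have ha := hloc p hp
    rw [hO] at ha
    exact exists_units_mem_locEq_of_finrank_le hΛ h1Λ hΛΛ hp (not_lt.1 hpn) ha

section MaximalOrder

variable [Fintype t]

/-- **DTZ62 THEOREM C OVER THE MAXIMAL ORDER `Λ_max = ⊕ᵢ 𝒪_{Lᵢ}`: if a full lattice `L` is `Λ_max`-stable at every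
prime `p < n = dim_ℚ Y` (`L_(p) = (LΛ_max)_(p)`; e.g. the index `[Λ_max : 𝒪(L)]` has no prime factor below `n`), then
`L^k` is invertible for every `k ≥ n − 1`** (`LΛ_max` is `Λ_max`-stable, hence in `G(Λ_max)` by the tree's
`pic_pi_integralClosure_iff` — HL Thm. 10.2 «one can choose `Λ = Λ_max`»).
[cite: HertlingLarabi2026, §10 Thm. 10.1 and the remark after it («In the case of an algebraic number field … one can choose `Λ = Λ_max`»), chunk p0026] [cite: DadeTausskyZassenhaus1962, §1.5 Theorem C] -/
theorem pow_mul_div_div_eq_of_forall_prime_lt_finrank_locEq_pi {M : Submodule ℤ (Π i, L i)}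
    (hM : IsFullLattice (Π i, L i) M)
    (hsmall : ∀ p : ℕ, p.Prime → p < finrank ℚ (Π i, L i) →
      ∃ s : ℤ, ¬ (p : ℤ) ∣ s ∧
        (∀ x ∈ M, s • x ∈ M * Submodule.pi Set.univ (fun i => Subalgebra.toSubmodule (integralClosure ℤ (L i)))) ∧
        (∀ x ∈ M * Submodule.pi Set.univ (fun i => Subalgebra.toSubmodule (integralClosure ℤ (L i))), s • x ∈ M))
    (hn : 2 ≤ finrank ℚ (Π i, L i)) :
    ∃ Λ₂ : Submodule ℤ (Π i, L i), (1 : Π i, L i) ∈ Λ₂ ∧ Λ₂ * Λ₂ = Λ₂ ∧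
      Λ₂ ≤ Submodule.pi Set.univ (fun i => Subalgebra.toSubmodule (integralClosure ℤ (L i))) ∧
      ∀ k : ℕ, finrank ℚ (Π i, L i) - 1 ≤ k →
        M ^ k * ((M ^ k / M ^ k) / M ^ k) = M ^ k / M ^ k ∧ M ^ k / M ^ k = Λ₂ := by
  have hΛ := isFullLattice_piIntegralSubmodule (L := L)
  have h1Λ := one_mem_piIntegralSubmodule (L := L)
  have hΛΛ : Submodule.pi Set.univ (fun i => Subalgebra.toSubmodule (integralClosure ℤ (L i))) *
      Submodule.pi Set.univ (fun i => Subalgebra.toSubmodule (integralClosure ℤ (L i))) ≤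
        Submodule.pi Set.univ (fun i => Subalgebra.toSubmodule (integralClosure ℤ (L i))) :=
    Submodule.mul_le.2 fun a ha b hb => mul_mem_piIntegralSubmodule ha hb
  obtain ⟨hO, hinv⟩ := (pic_pi_integralClosure_iff (isFullLattice_mul hM hΛ)).1 fun m hm a ha => by
    have h := Submodule.mul_mem_mul hm ha
    rw [mul_assoc] at h
    exact mul_le_mul_right hΛΛ M h
  exact pow_mul_div_div_eq_of_forall_prime_lt_finrank_locEq hM hΛ h1Λ hΛΛ hO hinv hsmall hn

/-- **DTZ62 THEOREM C IN DIMENSION `2`, UNCONDITIONALLY: every full lattice of a `2`-dimensional `Y` (a quadratic field,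
or `ℚ ⊕ ℚ`) is INVERTIBLE** (no prime lies below `n = 2`; `k = 1 ≥ n − 1`) — «for each full lattice `L` each power `L^k`
with `k ≥ n − 1` is invertible» at `n = 2`; for a quadratic FIELD this is the classical «every lattice is a proper
ideal of its order» (the tree's `QuadraticFields/QuadraticOrdersInvertibleLattices`, Cox Prop. 7.4, by another road).
[cite: HertlingLarabi2026, §10 Thm. 10.1 (n = 2), chunk p0026] [cite: DadeTausskyZassenhaus1962, §1.5 Theorem C] -/
theorem mul_div_div_eq_of_finrank_eq_two {M : Submodule ℤ (Π i, L i)} (hM : IsFullLattice (Π i, L i) M)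
    (h2 : finrank ℚ (Π i, L i) = 2) : M * ((M / M) / M) = M / M := by
  obtain ⟨Λ₂, -, -, -, h⟩ := pow_mul_div_div_eq_of_forall_prime_lt_finrank_locEq_pi hM
    (fun p hp hlt => absurd hp.two_le (by omega)) (by omega)
  have h1 := (h 1 (by omega)).1
  rwa [pow_one] at h1

end MaximalOrder

end LargePrimes

end Literature.NumberTheory.ComplexMultiplication
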